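import Summits.Ventures.PercRepro.GenQTraceLarge
import Summits.Ventures.PercRepro.GenQLargeSevenBase

/-!
# PercRepro — TRACE LARGE at level `7` (`TraceSumsCore 6`): `μ₆` for the chain `fCore` (night-4, gen 7)

The level-`7` trace sums of the `(9, 7)` cell live on the rank-`6` subsets `H` of the core (`|H| ≤ fCore 6 = 43`).
`mu6 = 6, 4, 3, 2, 1, 0` on `j ≤ 6, = 7, ≤ 9, ≤ 12, ≤ 22, ≥ 23` is `muQ 6 fCore` (`muQ_six`, by `decide` up to `22`
and `muQ_eq_zero_of_forall` beyond).  The numerics `0 ≤ lbSumT 6 fCore t n` are `GenQTraceSevenNumA … C`; the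
reduction of `TraceSumsCore 6` to its certificate residue is `GenQTraceSevenAll`.  Imports `GenQTraceLarge`,
`GenQLargeSevenBase` (`muQ_eq_zero_of_forall`).
-/
namespace PercRepro.Night4

open Finset ThmH SixFour GenQ PerFlat Star

/-- `fCore 4 = 10`. -/
theorem fCore_four : fCore 4 = 10 := rfl

/-- `fCore 5 = 21`. -/
theorem fCore_five : fCore 5 = 21 := rfl

/-- `μ₆(j)` explicitly: `6, 4, 3, 2, 1, 0` on `j ≤ 6, = 7, ≤ 9, ≤ 12, ≤ 22, ≥ 23`. -/
def mu6 (j : ℕ) : ℕ :=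
  if j ≤ 6 then 6 else if j ≤ 7 then 4 else if j ≤ 9 then 3 else if j ≤ 12 then 2 else if j ≤ 22 then 1 else 0

/-- **`muQ 6 fCore j = μ₆(j)`** at every `j`. -/
theorem muQ_six (j : ℕ) : muQ 6 fCore j = mu6 j := by
  by_cases hj : j ≤ 22
  · interval_cases j <;> decide
  · rw [muQ_eq_zero_of_forall (by omega)]
    · unfold mu6
      simp only [show ¬ j ≤ 6 by omega, show ¬ j ≤ 7 by omega, show ¬ j ≤ 9 by omega, show ¬ j ≤ 12 by omega,
        show ¬ j ≤ 22 by omega, if_false]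
    · intro m hm1 hm2
      interval_cases m <;> simp [fCore] <;> omega

end PercRepro.Night4
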